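import Summits.KontsevichZagierPeriods.KontsevichZagierPeriods.Theorems.LinRedNormalFormArrangementNormalFormStubRebaseSimplePosOnePosQuadMove
import Summits.KontsevichZagierPeriods.KontsevichZagierPeriods.Theorems.LinRedNormalFormArrangementNormalFormStubRebaseSimplePosOnePosQuadClose

/-!
# Stub `stub_rebaseSimplePosOnePos` (crux `ArrangementNormalForm`, line `janus-bands`) —
part `QuadSector`: the steep sector piece of a normalised flat cell is good (`B = 2`)

`B = 2` corner calculus: assembly of parts `QuadChart`, `QuadForms`, `QuadMove`, `QuadClose`.
A parallel transverse band (letter `0`, common slope `s ≠ 0`) over the product cell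
`{y-free rows Mx} × (a(x'), b(x'))` of the base `(x₁, x₂, y)`, in NORMALISED position — base
pole `y = 0`, the `η`-walls `a`, `b` and the bounds `u`, `v` LINEAR (the flat point is the
origin, the `y`-range pinches on the pole plane there and the apex of the band lies on the
letter there), the `y`-free rows linear or in `x₁` / in `x₂` alone, the far silent factors
parallel to an axis — restricted to the steep sector piece `{0 < x₁ < x₂ < ε}` of the silent
plane, is congruent modulo `KZ.relations` to the subgroup generated by `GG 2 2 1`
(`RebasePos.good_quadSteepPiece`): the chart `RebasePos.quadBlowUpSteep` (rule 2) produces a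
parallel band over the product cell `{(ρ, ξ)-rows} × (A(ξ), B(ξ))` with `ρ`-free walls and
bounds, which is `RebasePos.good_rhoFreeCell`. Registered as `rebaseSimplePos_quadSteepPiece`.

References: M. Kontsevich, D. Zagier, *Periods* (2001), §1.2, rules (1a), (2).
-/

noncomputable section

open Set MeasureTheory MvPolynomial
open Literature.NumberTheory.Transcendental Literature.ModelTheory.ExponentialFields

namespace Summit.KontsevichZagierPeriods.ArrangementNormalForm.JanusBands

namespace RebasePos

open SeparatePos

section QuadSector

variable {m mx : ℕ} (L : Fin m → (Fin 2 → ℚ) × ℚ) (e : Fin m → ℕ) (ℓ₁ : (Fin 2 → ℚ) × ℚ)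

/-- The lower `y`-wall `y − a(x') > 0` of a product cell, `a` linear. -/
def wallLoQ (a : (Fin 2 → ℚ) × ℚ) : (Fin (2 + 1) → ℚ) × ℚ := (![-a.1 0, -a.1 1, 1], 0)

/-- The upper `y`-wall `b(x') − y > 0` of a product cell, `b` linear. -/
def wallHiQ (b : (Fin 2 → ℚ) × ℚ) : (Fin (2 + 1) → ℚ) × ℚ := (![b.1 0, b.1 1, -1], 0)

/-- A linear `x'`-form `a₀ x₁ + a₁ x₂` divided by `x₂`, as a form in `ξ = x₁/x₂`: `a₀ ξ + a₁`. -/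
def wallChartQ (a : (Fin 2 → ℚ) × ℚ) : (Fin 2 → ℚ) × ℚ := (![0, a.1 0], a.1 1)

/-- A `y`-free row read as an `x'`-row of the charted product cell. -/
def rowChartQ (c : (Fin (2 + 1) → ℚ) × ℚ) : (Fin 2 → ℚ) × ℚ := restr 2 (chartRowQ c)

/-- The charted lower wall is the row `η − (a₀ ξ + a₁) > 0`. -/
theorem affF_chartRowQ_wallLo (a : (Fin 2 → ℚ) × ℚ) (w : Fin (2 + 1 + 1) → ℝ) :
    affF 2 1 (chartRowQ (wallLoQ a)) w = w 2 - affB 2 1 (wallChartQ a) w := by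
  rw [chartRowQ, wallLoQ, if_pos rfl, affF_three, affB_three, wallChartQ]
  simp
  ring

/-- The charted upper wall is the row `(b₀ ξ + b₁) − η > 0`. -/
theorem affF_chartRowQ_wallHi (b : (Fin 2 → ℚ) × ℚ) (w : Fin (2 + 1 + 1) → ℝ) :
    affF 2 1 (chartRowQ (wallHiQ b)) w = affB 2 1 (wallChartQ b) w - w 2 := by
  rw [chartRowQ, wallHiQ, if_pos rfl, affF_three, affB_three, wallChartQ]
  simp
  ring

/-- A charted `y`-free row of the allowed kinds is `η`-free. -/
theorem affF_chartRowQ_yfree (c : (Fin (2 + 1) → ℚ) × ℚ) (hc : c.1 2 = 0)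
    (hc' : c.2 ≠ 0 → (c.1 1 = 0 ∨ c.1 0 = 0)) (w : Fin (2 + 1 + 1) → ℝ) :
    affF 2 1 (chartRowQ c) w = affB 2 1 (rowChartQ c) w := by
  have _h := hc'
  rw [rowChartQ]
  by_cases h : c.2 = 0
  · rw [chartRowQ, if_pos h, affF_three, affB_three, restr, hc]
    simp
  · by_cases h1 : c.1 1 = 0
    · rw [chartRowQ, if_neg h, if_pos h1, affF_three, affB_three, restr, hc]
      simp
    · rw [chartRowQ, if_neg h, if_neg h1, affF_three, affB_three, restr]
      simp

/-- The charted sector rows are `η`-free. -/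
theorem affF_outRowsQ_yfree (ε : ℚ) (k : Fin 4) (w : Fin (2 + 1 + 1) → ℝ) :
    affF 2 1 (outRowsQ ε k) w = affB 2 1 (restr 2 (outRowsQ ε k)) w := by
  fin_cases k <;> simp [outRowsQ, affF_three, affB_three, restr]

/-- **The steep sector piece of a normalised flat cell is good** (`B = 2`). See the module
docstring. Rows: `y`-free rows `Mx` of the allowed kinds (`hMx`), the two linear `y`-walls
`a < y < b`, the four sector rows `0 < x₁ < x₂ < ε`; bounds `u < t < v` linear and parallel in
`y` with slope `s ≠ 0`; far silent factors parallel to an axis (`hL`); base pole `y = 0`. -/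
theorem good_quadSteepPiece (ε : ℚ) (s : KZ.IntegralRep (2 + 1 + 1)) (Mx : Fin mx → (Fin (2 + 1) → ℚ) × ℚ)
    (a b : (Fin 2 → ℚ) × ℚ) (p : MvPolynomial (Fin 2) ℚ) (u v : (Fin (2 + 1) → ℚ) × ℚ)
    (hdom : s.domain = gDom 2 1 (mx + 2 + 4) (Fin.append (Fin.append Mx ![wallLoQ a, wallHiQ b]) (boxRowsQ ε))
      (fun _ => Sum.inr u) (fun _ => Sum.inr v))
    (hint : EqOn s.integrand (glit 2 1 p L e ℓ₁ 0 0 1 (fun _ => some 0)) s.domain)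
    (hMx : ∀ j, (Mx j).1 2 = 0 ∧ ((Mx j).2 ≠ 0 → (Mx j).1 1 = 0 ∨ (Mx j).1 0 = 0))
    (hL : ∀ j, (L j).2 ≠ 0 → (L j).1 1 ≠ 0 → (L j).1 0 = 0)
    (hus : u.1 2 ≠ 0) (hpar : u.1 2 = v.1 2) (hu : u.2 = 0) (hv : v.2 = 0)
    (hcell : ∀ z : Fin (2 + 1 + 1) → ℝ, (∀ j, 0 < affF 2 1 ((Fin.append (Fin.append Mx ![wallLoQ a, wallHiQ b])
      (boxRowsQ ε) : Fin (mx + 2 + 4) → _) j) z) → 0 < affF 2 1 u z ∧ affF 2 1 u z < affF 2 1 v z) :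
    ∃ c ∈ AddSubgroup.closure (GGset 2 2 1), KZ.of s - c ∈ KZ.relations := by
  set M : Fin (mx + 2) → (Fin (2 + 1) → ℚ) × ℚ := Fin.append Mx ![wallLoQ a, wallHiQ b] with hM
  -- the rows are of the allowed kinds
  have hMrows : ∀ j, (M j).2 ≠ 0 → ((M j).1 1 = 0 ∧ (M j).1 2 = 0) ∨ ((M j).1 0 = 0 ∧ (M j).1 2 = 0) := by
    intro j
    rw [hM]
    refine Fin.addCases (fun i => ?_) (fun i => ?_) j
    · simp only [Fin.append_left]
      intro h
      rcases (hMx i).2 h with h1 | h0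
      · exact Or.inl ⟨h1, (hMx i).1⟩
      · exact Or.inr ⟨h0, (hMx i).1⟩
    · fin_cases i <;> simp [wallLoQ, wallHiQ]
  -- the cone condition `|y| ≤ K x₂` on the steep piece
  set K : ℝ := max (|(a.1 0 : ℝ)| + |(a.1 1 : ℝ)|) (|(b.1 0 : ℝ)| + |(b.1 1 : ℝ)|) with hK
  have hcone : ∀ z ∈ s.domain, |z 2| ≤ K * z 1 := by
    intro z hz
    rw [hdom, mem_gDom_append₂] at hz
    obtain ⟨⟨hrow, hbox⟩, -, -⟩ := hz
    obtain ⟨h0, h1, h01, -⟩ := boxRowsQ_pos ε z hbox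
    have hlo := hrow (Fin.natAdd mx 0)
    have hhi := hrow (Fin.natAdd mx 1)
    rw [hM] at hlo hhi
    simp only [Fin.append_right, Matrix.cons_val_zero, Matrix.cons_val_one] at hlo hhi
    rw [wallLoQ, affF_three] at hlo
    rw [wallHiQ, affF_three] at hhi
    simp only [Matrix.cons_val_zero, Matrix.cons_val_one, Matrix.cons_val, Rat.cast_neg, Rat.cast_one, one_mul,
      Rat.cast_zero, add_zero, neg_mul] at hlo hhi
    have hx0 : |z 0| ≤ z 1 := by rw [abs_of_pos h0]; exact h01.le
    have hx1 : |z 1| ≤ z 1 := (abs_of_pos h1).le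
    have e1 : |(a.1 0 : ℝ) * z 0| ≤ |(a.1 0 : ℝ)| * z 1 := by
      rw [abs_mul]; exact mul_le_mul_of_nonneg_left hx0 (abs_nonneg _)
    have e2 : |(a.1 1 : ℝ) * z 1| ≤ |(a.1 1 : ℝ)| * z 1 := by
      rw [abs_mul]; exact mul_le_mul_of_nonneg_left hx1 (abs_nonneg _)
    have e3 : |(b.1 0 : ℝ) * z 0| ≤ |(b.1 0 : ℝ)| * z 1 := by
      rw [abs_mul]; exact mul_le_mul_of_nonneg_left hx0 (abs_nonneg _)
    have e4 : |(b.1 1 : ℝ) * z 1| ≤ |(b.1 1 : ℝ)| * z 1 := by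
      rw [abs_mul]; exact mul_le_mul_of_nonneg_left hx1 (abs_nonneg _)
    have hKa : (|(a.1 0 : ℝ)| + |(a.1 1 : ℝ)|) * z 1 ≤ K * z 1 := mul_le_mul_of_nonneg_right (le_max_left _ _) h1.le
    have hKb : (|(b.1 0 : ℝ)| + |(b.1 1 : ℝ)|) * z 1 ≤ K * z 1 := mul_le_mul_of_nonneg_right (le_max_right _ _) h1.le
    rw [abs_le]
    constructor
    · have := neg_abs_le ((a.1 0 : ℝ) * z 0)
      have := neg_abs_le ((a.1 1 : ℝ) * z 1)
      nlinarith
    · have := le_abs_self ((b.1 0 : ℝ) * z 0)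
      have := le_abs_self ((b.1 1 : ℝ) * z 1)
      nlinarith
  -- the chart
  obtain ⟨s', hbd', hdom', hint', hmem', hrel⟩ :=
    quadBlowUpSteep ε K s M L e p ℓ₁ u v hdom hint hMrows hL hu hv hcone
  suffices h' : ∃ c ∈ AddSubgroup.closure (GGset 2 2 1), KZ.of s' - c ∈ KZ.relations by
    obtain ⟨c, hc, hc'⟩ := h'
    exact ⟨c, hc, by have := add_mem hrel hc'; rwa [sub_add_sub_cancel] at this⟩
  -- the charted datum is a `ρ`-free product cell
  set M₀' : Fin (mx + 4) → (Fin 2 → ℚ) × ℚ :=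
    Fin.append (fun j => rowChartQ (Mx j)) (fun k => restr 2 (outRowsQ ε k)) with hM₀'
  have hsec' : ∀ w : Fin (2 + 1 + 1) → ℝ,
      (∀ j, 0 < affF 2 1 ((Fin.append (fun j => chartRowQ (M j)) (outRowsQ ε) : Fin (mx + 2 + 4) → _) j) w) ↔
        ((∀ j, 0 < affB 2 1 (M₀' j) w) ∧ affB 2 1 (wallChartQ a) w < w (Fin.castAdd 1 (Fin.last 2)) ∧
          w (Fin.castAdd 1 (Fin.last 2)) < affB 2 1 (wallChartQ b) w) := by
    intro w
    rw [hM₀', hM, Fin.forall_fin_add, Fin.forall_fin_add, Fin.forall_fin_add, Fin.forall_fin_two, jy_eq]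
    simp only [Fin.append_left, Fin.append_right, Matrix.cons_val_zero, Matrix.cons_val_one,
      affF_chartRowQ_wallLo, affF_chartRowQ_wallHi, affF_chartRowQ_yfree _ (hMx _).1 (hMx _).2,
      affF_outRowsQ_yfree, sub_pos]
    tauto
  refine good_rhoFreeCell (chartLsQ L) (chartEsQ p L e) 0 0 s' _ M₀' (wallChartQ a) (wallChartQ b) (chartPQ p L e)
    (chartFQ u) (chartFQ v) hbd' hdom' (fun w _ => by rw [hint']) ?_ ?_ (fun w hw => ?_) hsec' ?_
  · simpa [chartFQ] using hus
  · simpa [chartFQ] using hpar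
  · -- `0 < U < V` from `0 < u < v` at `blowQ w`
    rw [Fin.forall_fin_add] at hw
    obtain ⟨hrow, hbox⟩ := hw
    simp only [Fin.append_left, Fin.append_right] at hrow hbox
    obtain ⟨hρ, hξ, -, -⟩ := outRowsQ_bounds ε w hbox
    have hq : 0 < w 0 / w 1 := div_pos hρ hξ
    have hz : ∀ j, 0 < affF 2 1 ((Fin.append M (boxRowsQ ε) : Fin (mx + 2 + 4) → _) j) (blowQ w) := by
      rw [Fin.forall_fin_add]
      refine ⟨fun j => ?_, ?_⟩
      · rw [Fin.append_left]
        exact (affF_blowQ_pos_iff (M j) (hMrows j) w hρ hξ).2 (hrow j)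
      · simp only [Fin.append_right]
        exact (boxRowsQ_iff ε w).2 hbox
    obtain ⟨h1, h2⟩ := hcell (blowQ w) hz
    rw [affF_blowQ_lin u hu w hξ.ne'] at h1 h2
    rw [affF_blowQ_lin v hv w hξ.ne'] at h2
    exact ⟨pos_of_mul_pos_right h1 hq.le, lt_of_mul_lt_mul_left h2 hq.le⟩
  · simp [wallChartQ, chartFQ]

end QuadSector

end RebasePos

/-- **Registered part of `stub_rebaseSimplePosOnePos` (line `janus-bands`, `B = 2` corner
calculus): the steep sector piece of a normalised flat cell is good.** A parallel transverse
band (letter `0`, slope `s ≠ 0`, base pole `y = 0`) over the product cell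
`{y-free rows} × (a(x'), b(x'))` of the base `(x₁, x₂, y)` with LINEAR walls and bounds (flat
point at the origin on the pole plane and on the letter), `y`-free rows linear or in one silent
coordinate, far silent factors parallel to an axis, restricted to `{0 < x₁ < x₂ < ε}`:
`[s] ∈ closure (GG 2 2 1)` modulo `KZ.relations` — the chart `rebaseSimplePos_quadBlowUpSteep`
followed by `rebaseSimplePos_rhoFreeCell` (`RebasePos.good_quadSteepPiece`). -/
theorem rebaseSimplePos_quadSteepPiece (m mx : ℕ) (ε : ℚ) (s : KZ.IntegralRep (2 + 1 + 1)) (Mx : Fin mx → (Fin (2 + 1) → ℚ) × ℚ) (a b : (Fin 2 → ℚ) × ℚ) (L : Fin m → (Fin 2 → ℚ) × ℚ) (e : Fin m → ℕ) (p : MvPolynomial (Fin 2) ℚ) (ℓ₁ : (Fin 2 → ℚ) × ℚ) (u v : (Fin (2 + 1) → ℚ) × ℚ) (hdom : s.domain = SeparatePos.gDom 2 1 (mx + 2 + 4) (Fin.append (Fin.append Mx ![RebasePos.wallLoQ a, RebasePos.wallHiQ b]) (RebasePos.boxRowsQ ε)) (fun _ => Sum.inr u) (fun _ => Sum.inr v))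 (hint : Set.EqOn s.integrand (RebasePos.glit 2 1 p L e ℓ₁ 0 0 1 (fun _ => some 0)) s.domain) (hMx : ∀ j, (Mx j).1 2 = 0 ∧ ((Mx j).2 ≠ 0 → (Mx j).1 1 = 0 ∨ (Mx j).1 0 = 0)) (hL : ∀ j, (L j).2 ≠ 0 → (L j).1 1 ≠ 0 → (L j).1 0 = 0) (hus : u.1 2 ≠ 0) (hpar : u.1 2 = v.1 2) (hu : u.2 = 0) (hv : v.2 = 0) (hcell : ∀ z : Fin (2 + 1 + 1) → ℝ, (∀ j, 0 < SeparatePos.affF 2 1 ((Fin.append (Fin.append Mx ![RebasePos.wallLoQ a, RebasePos.wallHiQ b]) (RebasePos.boxRowsQ ε) : Fin (mx + 2 + 4) → _) j) z) → 0 < SeparatePos.affF 2 1 u z ∧ SeparatePos.affF 2 1 u z < SeparatePos.affF 2 1 v z) : ∃ c ∈ AddSubgroup.closure (SeparatePos.GGset 2 2 1), KZ.of s - c ∈ KZ.relations :=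
  RebasePos.good_quadSteepPiece L e ℓ₁ ε s Mx a b p u v hdom hint hMx hL hus hpar hu hv hcell

end Summit.KontsevichZagierPeriods.ArrangementNormalForm.JanusBands
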